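import Summits.QuantumFields.BalabanUV.Beta.GAN24.ArrowInnerShiftScalars
import Summits.QuantumFields.BalabanUV.Beta.GAN24.SourceSideMajorant

/-!
# `BalabanUV.Beta.GAN24.ArrowInnerShiftZeroBorder` — binder row G-an2-4 / (CONV-C), road P1-fibre, row **P1-L10-F4** (`ArrowInnerShift`) of the
# L10 owner's cut `HOME/b2b-balaban-gan24-formalise-leaf-16/L10-CUT-M4.md` («(M4) scaled alias-space Neumann, two anchors»), PART 1b:
# the ZERO-ALIAS BORDER WEIGHTS of the arrow operator — `s_κ(0)(p) = G(p_κ/N, N)`, `S(0)(p)`, `χ̂_0(p)` stay `O(ρ)`-close to their anchor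
# values `N`, `N^D`, `1` (the signed-permutation entries of `F̃_N(0)`), UNIFORMLY IN `N`, on the complex polydisc `‖p_i‖ ≤ ρ ≤ 1`

NOT IN PRINT; OUR PROOF ATTEMPT.  HONEST FRAMING (cell contract, verbatim): «discharging `BetaPertH` makes Bałaban's UV stability
UNCONDITIONAL — a real constructive-QFT result; it is NOT the continuum limit and NOT the Clay problem.»  HONEST DEPENDENCY (verbatim):
«continuum YM on T⁴ ⇐ BetaPertH ∧ nine spine estimates (0/9 proved); BetaPertH ⇐ (D1) ∧ (D4) ∧ CAP+tail; G-an2-4 gates asym, D1 and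
NE2/3/4.»  [folklore] bookkeeping estimates (termwise geometric sums, a product telescope); NO cited fact, NO `def … : Prop` hypothesis, NO
wall binder, NO new object (0 `def`).  NOT summit progress; nothing of (CONV-C)'s K-slot is discharged here.

## Why (row F4 of the cut, the `m = 0` borders; gan24-p1-g2's ratification CLAIMS l.3191 (1): «INNER scaling at p = 0 gives EXACTLY blockdiag ⊕ a signed permutation»)
In the inner scaling the four zero-alias border entries of `F̃_N(p)` are `−χ̂_0(p)·s♭_κ(0)(p)/N` (EL₀–φ_κ), `−χ̂_0(p)` (G₀–c), `S(0)(p)·s_κ(0)(p)/N^{D+1}`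
(Q_κ–A₀) and `S(0)(p)/N^D` (M–μ̂₀); at `p = 0` they are `∓1`.  This file bounds their distance to `±1` by `c(D)·ρ` for `‖p_i‖ ≤ ρ ≤ 1`, every `N ≥ 1`
— the zero-alias border share of `‖F̃_N(p) − F̃_N(0)‖ ≤ cIn(D)·|p|∞`.  Alias currency of `GAN24/AliasObjects` (`gs`, `sAl`, `sbAl`, `SAl`, `SbAl`, `chiAl`);
the arrow weights are these by `AliasFibreBridge.sflat_eq_sbAl / boxS_eq_SAl / chiHat_eq_chiAl / boxSs_eq_SAl_mul_sAl`.  Independent of F1/F2.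

## What is proved (general `D`, `N ≥ 1`, `hp : ∀ i, ‖p i‖ ≤ ρ`, `0 ≤ ρ ≤ 1`)
* §1 `norm_gs_sub_natCast_le` (`‖G(w, n) − n‖ ≤ 2‖w‖·n²` whenever `‖w‖·n ≤ 1`, termwise from `‖e^{iwt} − 1‖ ≤ 2‖w‖t`), **`norm_sAl_origin_sub_le`**
  (`‖s_κ(0)(p) − N‖ ≤ 2ρN`) and the flat twin `norm_sbAl_origin_sub_le`, the normalised forms `norm_sAl_origin_div_sub_one_le` (`‖s_κ(0)(p)/N − 1‖ ≤ 2ρ`),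
  `norm_sAl_origin_div_le` (`‖s_κ(0)(p)/N‖ ≤ 3`) and flat twins.
* §2 the constant form `norm_prod_sub_one_le` (`‖Π_j a_j − 1‖ ≤ D·3^D·δ`) of the product telescope `SourceSideMajorant.norm_prod_sub_prod_le` (BY NAME).
* §3 `SAl_origin_div_eq_prod` / `chiAl_origin_eq_prod` (`S(0)/N^D = Π_i s_i(0)/N`, `χ̂_0 = Π_i s♭_i(0)/N`), **`norm_SAl_origin_div_sub_one_le`**
  (`‖S(0)(p)/N^D − 1‖ ≤ 2D·3^D·ρ`), **`norm_chiAl_origin_sub_one_le`** (`‖χ̂_0(p) − 1‖ ≤ 2D·3^D·ρ`), `norm_SAl_origin_sub_le` (un-normalised),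
  `norm_mul_sub_one_le`, and the two composite entries **`norm_chiAl_mul_sbAl_origin_div_sub_one_le`** (EL₀–φ: `≤ (6D·3^D + 2)ρ`),
  **`norm_SAl_mul_sAl_origin_div_sub_one_le`** (Q–A₀: `≤ (6D·3^D + 2)ρ`).
Constants displayed and symbolic in `D` (TRIGGER-P1 c3; `3^D` where `3^{D−1}` would do); no float enters any statement.
Unit `b2b-balaban-gan24-formalise-leaf-04` (G-an2-4 formalisation swarm, gen 5), 2026-08-20.
-/

noncomputable section

open Complex Finset
open scoped BigOperators Real
open Literature.Probability.LatticeModels (TorusSite)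
open Summit.QuantumFields.BalabanUV.Beta.GAN24.AliasObjects (kAl gs sAl SAl sbAl SbAl chiAl)
open Summit.QuantumFields.BalabanUV.Beta.GAN24.AliasStripSymbols (norm_cexp_I_mul_sub_one_le_two_mul)
open Summit.QuantumFields.BalabanUV.Beta.GAN24.ArrowInnerShiftScalars (kAl_origin)
open Summit.QuantumFields.BalabanUV.Beta.GAN24.SourceSideMajorant (norm_prod_sub_prod_le)

namespace Summit.QuantumFields.BalabanUV.Beta.GAN24.ArrowInnerShiftZeroBorder

variable {D : ℕ} {N : ℕ} [NeZero N]

/-! ## §1 The zero-alias contour weights `s_κ(0)(p) = G(p_κ/N, N)` -/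


/-- [folklore] TERMWISE GEOMETRIC-SUM SHIFT: `‖G(w, n) − n‖ ≤ 2‖w‖·n²` whenever `‖w‖·n ≤ 1` (each term `‖e^{iwt} − 1‖ ≤ 2‖w‖t ≤ 2‖w‖n`). -/
theorem norm_gs_sub_natCast_le {w : ℂ} {n : ℕ} (hw : ‖w‖ * n ≤ 1) : ‖gs w n - n‖ ≤ 2 * ‖w‖ * (n : ℝ) ^ 2 := by
  unfold AliasObjects.gs
  have hn : ((n : ℕ) : ℂ) = ∑ _t ∈ Finset.range n, (1 : ℂ) := by simp
  rw [hn, ← Finset.sum_sub_distrib]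
  have hw0 : 0 ≤ ‖w‖ := norm_nonneg w
  have hterm : ∀ t ∈ Finset.range n, ‖cexp (I * w * t) - 1‖ ≤ 2 * ‖w‖ * n := by
    intro t ht
    have htn : (t : ℝ) ≤ n := by exact_mod_cast (Finset.mem_range.1 ht).le
    have ht0 : (0 : ℝ) ≤ t := Nat.cast_nonneg t
    have hwt : ‖w * (t : ℂ)‖ ≤ 1 := by
      rw [norm_mul, Complex.norm_natCast]
      exact (mul_le_mul_of_nonneg_left htn hw0).trans hw
    rw [show I * w * (t : ℂ) = I * (w * t) by ring]
    calc ‖cexp (I * (w * t)) - 1‖ ≤ 2 * ‖w * (t : ℂ)‖ := norm_cexp_I_mul_sub_one_le_two_mul hwt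
      _ = 2 * ‖w‖ * t := by rw [norm_mul, Complex.norm_natCast]; ring
      _ ≤ 2 * ‖w‖ * n := by nlinarith
  calc ‖∑ t ∈ Finset.range n, (cexp (I * w * t) - 1)‖ ≤ ∑ t ∈ Finset.range n, ‖cexp (I * w * t) - 1‖ := norm_sum_le _ _
    _ ≤ ∑ _t ∈ Finset.range n, 2 * ‖w‖ * n := Finset.sum_le_sum hterm
    _ = 2 * ‖w‖ * (n : ℝ) ^ 2 := by rw [Finset.sum_const, Finset.card_range, nsmul_eq_mul]; ring

/-- [folklore] **ZERO-ALIAS CONTOUR WEIGHT**: `‖s_κ(0)(p) − N‖ ≤ 2ρ·N` (`s_κ(0)(p) = G(p_κ/N, N)`, anchor value `N`). -/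
theorem norm_sAl_origin_sub_le {p : Fin D → ℂ} {ρ : ℝ} (hp : ∀ i, ‖p i‖ ≤ ρ) (hρ1 : ρ ≤ 1) (κ : Fin D) :
    ‖sAl N p (0 : TorusSite D N) κ - N‖ ≤ 2 * ρ * N := by
  unfold AliasObjects.sAl
  rw [kAl_origin]
  have hN : (0 : ℝ) < (N : ℝ) := by exact_mod_cast Nat.pos_of_ne_zero (NeZero.ne N)
  have hw : ‖p κ / (N : ℂ)‖ * N ≤ 1 := by
    rw [norm_div, Complex.norm_natCast, div_mul_cancel₀ _ hN.ne']
    exact (hp κ).trans hρ1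
  calc ‖gs (p κ / (N : ℂ)) N - N‖ ≤ 2 * ‖p κ / (N : ℂ)‖ * (N : ℝ) ^ 2 := norm_gs_sub_natCast_le hw
    _ = 2 * ‖p κ‖ * N := by rw [norm_div, Complex.norm_natCast]; field_simp
    _ ≤ 2 * ρ * N := by nlinarith [hp κ]

/-- [folklore] **ZERO-ALIAS REFLECTED CONTOUR WEIGHT**: `‖s♭_κ(0)(p) − N‖ ≤ 2ρ·N`. -/
theorem norm_sbAl_origin_sub_le {p : Fin D → ℂ} {ρ : ℝ} (hp : ∀ i, ‖p i‖ ≤ ρ) (hρ1 : ρ ≤ 1) (κ : Fin D) :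
    ‖sbAl N p (0 : TorusSite D N) κ - N‖ ≤ 2 * ρ * N := by
  unfold AliasObjects.sbAl
  rw [kAl_origin]
  have hN : (0 : ℝ) < (N : ℝ) := by exact_mod_cast Nat.pos_of_ne_zero (NeZero.ne N)
  have hw : ‖-(p κ / (N : ℂ))‖ * N ≤ 1 := by
    rw [norm_neg, norm_div, Complex.norm_natCast, div_mul_cancel₀ _ hN.ne']
    exact (hp κ).trans hρ1
  calc ‖gs (-(p κ / (N : ℂ))) N - N‖ ≤ 2 * ‖-(p κ / (N : ℂ))‖ * (N : ℝ) ^ 2 := norm_gs_sub_natCast_le hw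
    _ = 2 * ‖p κ‖ * N := by rw [norm_neg, norm_div, Complex.norm_natCast]; field_simp
    _ ≤ 2 * ρ * N := by nlinarith [hp κ]

/-- [folklore] NORMALISED: `‖s_κ(0)(p)/N − 1‖ ≤ 2ρ`. -/
theorem norm_sAl_origin_div_sub_one_le {p : Fin D → ℂ} {ρ : ℝ} (hp : ∀ i, ‖p i‖ ≤ ρ) (hρ1 : ρ ≤ 1) (κ : Fin D) :
    ‖sAl N p (0 : TorusSite D N) κ / N - 1‖ ≤ 2 * ρ := by
  have hN : (0 : ℝ) < (N : ℝ) := by exact_mod_cast Nat.pos_of_ne_zero (NeZero.ne N)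
  have hN' : (N : ℂ) ≠ 0 := Nat.cast_ne_zero.2 (NeZero.ne N)
  have e : sAl N p (0 : TorusSite D N) κ / N - 1 = (sAl N p (0 : TorusSite D N) κ - N) / N := by field_simp
  rw [e, norm_div, Complex.norm_natCast, div_le_iff₀ hN]
  exact norm_sAl_origin_sub_le hp hρ1 κ

/-- [folklore] NORMALISED: `‖s♭_κ(0)(p)/N − 1‖ ≤ 2ρ`. -/
theorem norm_sbAl_origin_div_sub_one_le {p : Fin D → ℂ} {ρ : ℝ} (hp : ∀ i, ‖p i‖ ≤ ρ) (hρ1 : ρ ≤ 1) (κ : Fin D) :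
    ‖sbAl N p (0 : TorusSite D N) κ / N - 1‖ ≤ 2 * ρ := by
  have hN : (0 : ℝ) < (N : ℝ) := by exact_mod_cast Nat.pos_of_ne_zero (NeZero.ne N)
  have hN' : (N : ℂ) ≠ 0 := Nat.cast_ne_zero.2 (NeZero.ne N)
  have e : sbAl N p (0 : TorusSite D N) κ / N - 1 = (sbAl N p (0 : TorusSite D N) κ - N) / N := by field_simp
  rw [e, norm_div, Complex.norm_natCast, div_le_iff₀ hN]
  exact norm_sbAl_origin_sub_le hp hρ1 κ

/-- [folklore] NORMALISED SIZE: `‖s_κ(0)(p)/N‖ ≤ 3` (for `ρ ≤ 1`). -/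
theorem norm_sAl_origin_div_le {p : Fin D → ℂ} {ρ : ℝ} (hp : ∀ i, ‖p i‖ ≤ ρ) (hρ1 : ρ ≤ 1) (κ : Fin D) :
    ‖sAl N p (0 : TorusSite D N) κ / N‖ ≤ 3 := by
  have h := norm_sAl_origin_div_sub_one_le hp hρ1 κ (N := N)
  have e : sAl N p (0 : TorusSite D N) κ / N = 1 + (sAl N p (0 : TorusSite D N) κ / N - 1) := by ring
  rw [e]
  refine (norm_add_le _ _).trans ?_
  rw [norm_one]; linarith

/-- [folklore] NORMALISED SIZE: `‖s♭_κ(0)(p)/N‖ ≤ 3`. -/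
theorem norm_sbAl_origin_div_le {p : Fin D → ℂ} {ρ : ℝ} (hp : ∀ i, ‖p i‖ ≤ ρ) (hρ1 : ρ ≤ 1) (κ : Fin D) :
    ‖sbAl N p (0 : TorusSite D N) κ / N‖ ≤ 3 := by
  have h := norm_sbAl_origin_div_sub_one_le hp hρ1 κ (N := N)
  have e : sbAl N p (0 : TorusSite D N) κ / N = 1 + (sbAl N p (0 : TorusSite D N) κ / N - 1) := by ring
  rw [e]
  refine (norm_add_le _ _).trans ?_
  rw [norm_one]; linarith

/-! ## §2 The product telescope, constant-majorant form -/

/-- [folklore] CONSTANT-MAJORANT FORM over `Fin D` against the anchor product `1`: if `‖a_j‖ ≤ 3` and `‖a_j − 1‖ ≤ δ` for every `j` then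
`‖Π_j a_j − 1‖ ≤ D·3^D·δ` (the sharper `3^{D−1}` is not needed downstream). -/
theorem norm_prod_sub_one_le (a : Fin D → ℂ) {δ : ℝ} (hδ : 0 ≤ δ) (h3 : ∀ j, ‖a j‖ ≤ 3) (h1 : ∀ j, ‖a j - 1‖ ≤ δ) :
    ‖∏ j, a j - 1‖ ≤ D * 3 ^ D * δ := by
  have h := norm_prod_sub_prod_le (Finset.univ : Finset (Fin D)) a (fun _ => (1 : ℂ)) (fun _ => (3 : ℝ))
    (fun j _ => h3 j) (fun j _ => by rw [norm_one]; norm_num)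
  rw [Finset.prod_const_one] at h
  refine h.trans ?_
  have hcard : ∀ i : Fin D, ∏ _j ∈ (Finset.univ : Finset (Fin D)).erase i, (3 : ℝ) ≤ 3 ^ D := by
    intro i
    rw [Finset.prod_const, Finset.card_erase_of_mem (Finset.mem_univ i), Finset.card_univ, Fintype.card_fin]
    exact pow_le_pow_right₀ (by norm_num) (Nat.sub_le D 1)
  calc ∑ i, ‖a i - 1‖ * ∏ _j ∈ (Finset.univ : Finset (Fin D)).erase i, (3 : ℝ)
      ≤ ∑ _i : Fin D, δ * 3 ^ D := Finset.sum_le_sum fun i _ =>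
        mul_le_mul (h1 i) (hcard i) (Finset.prod_nonneg fun _ _ => by norm_num) hδ
    _ = D * 3 ^ D * δ := by rw [Finset.sum_const, Finset.card_univ, Fintype.card_fin, nsmul_eq_mul]; ring

/-! ## §3 The box factor `S(0)(p)`, the block phase `χ̂_0(p)` and the two composite border entries -/

/-- [folklore] The normalised box factor is the product of the normalised contour weights: `S(0)(p)/N^D = Π_i (s_i(0)(p)/N)`. -/
theorem SAl_origin_div_eq_prod (p : Fin D → ℂ) :
    SAl N p (0 : TorusSite D N) / (N : ℂ) ^ D = ∏ i, (sAl N p (0 : TorusSite D N) i / N) := by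
  unfold AliasObjects.SAl
  rw [Finset.prod_div_distrib, Finset.prod_const, Finset.card_univ, Fintype.card_fin]

/-- [folklore] Flat twin: `S♭(0)(p)/N^D = Π_i (s♭_i(0)(p)/N)`, i.e. `χ̂_0(p) = Π_i (s♭_i(0)(p)/N)`. -/
theorem chiAl_origin_eq_prod (p : Fin D → ℂ) :
    chiAl N p (0 : TorusSite D N) = ∏ i, (sbAl N p (0 : TorusSite D N) i / N) := by
  unfold AliasObjects.chiAl AliasObjects.SbAl
  rw [Finset.prod_div_distrib, Finset.prod_const, Finset.card_univ, Fintype.card_fin]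

/-- [folklore] **ZERO-ALIAS BOX FACTOR**: `‖S(0)(p)/N^D − 1‖ ≤ 2D·3^D·ρ` (anchor value `S(0)(0) = N^D`). -/
theorem norm_SAl_origin_div_sub_one_le {p : Fin D → ℂ} {ρ : ℝ} (hp : ∀ i, ‖p i‖ ≤ ρ) (hρ0 : 0 ≤ ρ) (hρ1 : ρ ≤ 1) :
    ‖SAl N p (0 : TorusSite D N) / (N : ℂ) ^ D - 1‖ ≤ 2 * D * 3 ^ D * ρ := by
  rw [SAl_origin_div_eq_prod]
  have h := norm_prod_sub_one_le (fun i => sAl N p (0 : TorusSite D N) i / N) (by positivity : (0 : ℝ) ≤ 2 * ρ)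
    (fun j => norm_sAl_origin_div_le hp hρ1 j) (fun j => norm_sAl_origin_div_sub_one_le hp hρ1 j)
  refine h.trans (le_of_eq ?_)
  ring

/-- [folklore] **ZERO-ALIAS BLOCK PHASE**: `‖χ̂_0(p) − 1‖ ≤ 2D·3^D·ρ` (anchor value `χ̂_0(0) = 1`). -/
theorem norm_chiAl_origin_sub_one_le {p : Fin D → ℂ} {ρ : ℝ} (hp : ∀ i, ‖p i‖ ≤ ρ) (hρ0 : 0 ≤ ρ) (hρ1 : ρ ≤ 1) :
    ‖chiAl N p (0 : TorusSite D N) - 1‖ ≤ 2 * D * 3 ^ D * ρ := by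
  rw [chiAl_origin_eq_prod]
  have h := norm_prod_sub_one_le (fun i => sbAl N p (0 : TorusSite D N) i / N) (by positivity : (0 : ℝ) ≤ 2 * ρ)
    (fun j => norm_sbAl_origin_div_le hp hρ1 j) (fun j => norm_sbAl_origin_div_sub_one_le hp hρ1 j)
  refine h.trans (le_of_eq ?_)
  ring

/-- [folklore] `‖S(0)(p) − N^D‖ ≤ 2D·3^D·ρ·N^D` (the un-normalised form). -/
theorem norm_SAl_origin_sub_le {p : Fin D → ℂ} {ρ : ℝ} (hp : ∀ i, ‖p i‖ ≤ ρ) (hρ0 : 0 ≤ ρ) (hρ1 : ρ ≤ 1) :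
    ‖SAl N p (0 : TorusSite D N) - (N : ℂ) ^ D‖ ≤ 2 * D * 3 ^ D * ρ * (N : ℝ) ^ D := by
  have h := norm_SAl_origin_div_sub_one_le hp hρ0 hρ1 (N := N)
  have hN : (0 : ℝ) < (N : ℝ) ^ D := pow_pos (by exact_mod_cast Nat.pos_of_ne_zero (NeZero.ne N)) D
  have hN' : ((N : ℂ)) ^ D ≠ 0 := pow_ne_zero D (Nat.cast_ne_zero.2 (NeZero.ne N))
  have e : SAl N p (0 : TorusSite D N) / (N : ℂ) ^ D - 1 = (SAl N p (0 : TorusSite D N) - (N : ℂ) ^ D) / (N : ℂ) ^ D := by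
    field_simp
  rw [e, norm_div, norm_pow, Complex.norm_natCast, div_le_iff₀ hN] at h
  exact h

/-- [folklore] Two-factor rule against the anchor `1`: `‖x·y − 1‖ ≤ ‖x − 1‖·‖y‖ + ‖y − 1‖`. -/
theorem norm_mul_sub_one_le (x y : ℂ) : ‖x * y - 1‖ ≤ ‖x - 1‖ * ‖y‖ + ‖y - 1‖ := by
  have e : x * y - 1 = (x - 1) * y + (y - 1) := by ring
  rw [e]
  exact (norm_add_le _ _).trans (by rw [norm_mul])

/-- [folklore] **THE SCALED `EL₀–φ` ENTRY** (`χ̂_0 s♭_κ(0)/N`, anchor `1`, sign apart): `‖χ̂_0(p)·s♭_κ(0)(p)/N − 1‖ ≤ (6D·3^D + 2)·ρ`. -/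
theorem norm_chiAl_mul_sbAl_origin_div_sub_one_le {p : Fin D → ℂ} {ρ : ℝ} (hp : ∀ i, ‖p i‖ ≤ ρ) (hρ0 : 0 ≤ ρ) (hρ1 : ρ ≤ 1)
    (κ : Fin D) : ‖chiAl N p (0 : TorusSite D N) * (sbAl N p (0 : TorusSite D N) κ / N) - 1‖ ≤ (6 * D * 3 ^ D + 2) * ρ := by
  have h1 := norm_chiAl_origin_sub_one_le hp hρ0 hρ1 (N := N)
  have h2 := norm_sbAl_origin_div_le hp hρ1 κ (N := N)
  have h3 := norm_sbAl_origin_div_sub_one_le hp hρ1 κ (N := N)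
  calc ‖chiAl N p (0 : TorusSite D N) * (sbAl N p (0 : TorusSite D N) κ / N) - 1‖
      ≤ ‖chiAl N p (0 : TorusSite D N) - 1‖ * ‖sbAl N p (0 : TorusSite D N) κ / N‖ + ‖sbAl N p (0 : TorusSite D N) κ / N - 1‖ :=
        norm_mul_sub_one_le _ _
    _ ≤ (2 * D * 3 ^ D * ρ) * 3 + 2 * ρ := add_le_add (mul_le_mul h1 h2 (norm_nonneg _) (by positivity)) h3
    _ = (6 * D * 3 ^ D + 2) * ρ := by ring

/-- [folklore] **THE SCALED `Q–A₀` ENTRY** (`S(0) s_κ(0)/N^{D+1}`, anchor `1`): `‖(S(0)(p)/N^D)·(s_κ(0)(p)/N) − 1‖ ≤ (6D·3^D + 2)·ρ`. -/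
theorem norm_SAl_mul_sAl_origin_div_sub_one_le {p : Fin D → ℂ} {ρ : ℝ} (hp : ∀ i, ‖p i‖ ≤ ρ) (hρ0 : 0 ≤ ρ) (hρ1 : ρ ≤ 1)
    (κ : Fin D) :
    ‖SAl N p (0 : TorusSite D N) / (N : ℂ) ^ D * (sAl N p (0 : TorusSite D N) κ / N) - 1‖ ≤ (6 * D * 3 ^ D + 2) * ρ := by
  have h1 := norm_SAl_origin_div_sub_one_le hp hρ0 hρ1 (N := N)
  have h2 := norm_sAl_origin_div_le hp hρ1 κ (N := N)
  have h3 := norm_sAl_origin_div_sub_one_le hp hρ1 κ (N := N)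
  calc ‖SAl N p (0 : TorusSite D N) / (N : ℂ) ^ D * (sAl N p (0 : TorusSite D N) κ / N) - 1‖
      ≤ ‖SAl N p (0 : TorusSite D N) / (N : ℂ) ^ D - 1‖ * ‖sAl N p (0 : TorusSite D N) κ / N‖
          + ‖sAl N p (0 : TorusSite D N) κ / N - 1‖ := norm_mul_sub_one_le _ _
    _ ≤ (2 * D * 3 ^ D * ρ) * 3 + 2 * ρ := add_le_add (mul_le_mul h1 h2 (norm_nonneg _) (by positivity)) h3
    _ = (6 * D * 3 ^ D + 2) * ρ := by ring

end Summit.QuantumFields.BalabanUV.Beta.GAN24.ArrowInnerShiftZeroBorder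

end
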